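import Summits.Ventures.PercRepro.GenQFlatFacts

/-!
# PercRepro — a simple rank-`r` set with `s` points has at least `1 + 2(s − r)` bases (night-4, gen 7)

The row (H4) of the hyperplane-trace block (sheet §62 (k4)): take a basis `B` of `X`; every `x ∈ X ∖ B` has a
fundamental circuit `C_x ⊆ B ∪ {x}` with `≥ 3` elements (`Simple M`: every pair has rank `2`), and every
`y ∈ C_x ∖ {x}` gives the basis `B − y + x`; these bases are distinct and differ from `B`.  Imports `GenQFlatFacts`.
-/
namespace PercRepro.Night4

open Finset ThmH SixFour GenQ PerFlat Star

variable {α : Type*} [DecidableEq α] {M : Matroid α} [M.Finite]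

/-- The `r`-subsets of rank `r` of `X` (its bases). -/
noncomputable def basesOf (M : Matroid α) [M.Finite] (X : Finset α) (r : ℕ) : Finset (Finset α) :=
  (X.powersetCard r).filter (fun B : Finset α => M.eRk (B : Set α) = (r : ℕ∞))

omit [DecidableEq α] [M.Finite] in
/-- A circuit of a simple matroid that is not a single loop has at least `3` elements (a dependent pair has rank `1`,
against `Simple`). -/
theorem three_le_encard_of_isCircuit (hs : Simple M) {C : Set α} (hC : M.IsCircuit C) (hne : ∀ e, C ≠ {e}) :
    3 ≤ C.encard := by
  have h1 := hC.eRk_add_one_eq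
  have hCE : C ⊆ M.E := hC.subset_ground
  by_contra h
  rw [not_le] at h
  have hfin : C.Finite := Set.finite_of_encard_le_coe (le_of_lt (by exact_mod_cast h : C.encard < (3 : ℕ)))
  obtain ⟨n, hn⟩ : ∃ n : ℕ, C.encard = n := ⟨hfin.toFinset.card, hfin.encard_eq_coe_toFinset_card⟩
  have hn3 : n < 3 := by exact_mod_cast (hn ▸ h)
  have hn0 : n ≠ 0 := by
    intro h0
    rw [h0] at hn
    exact hC.nonempty.ne_empty (Set.encard_eq_zero.1 (by exact_mod_cast hn))
  rcases (show n = 1 ∨ n = 2 by omega) with rfl | rfl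
  · obtain ⟨e, rfl⟩ := Set.encard_eq_one.1 (by exact_mod_cast hn)
    exact hne e rfl
  · obtain ⟨e, e', hne', rfl⟩ := Set.encard_eq_two.1 (by exact_mod_cast hn)
    have hrk : M.eRk ({e, e'} : Set α) + 1 = (2 : ℕ) := by rw [h1, hn]
    have h2 := hs e (hCE (Set.mem_insert e _)) e' (hCE (Set.mem_insert_of_mem e (Set.mem_singleton e'))) hne'
    rw [h2] at hrk
    exact absurd hrk (by decide)

omit [DecidableEq α] [M.Finite] in
/-- In a simple matroid with two distinct points `x, b` of the ground set, `x` is not a loop: `rk {x} ≠ 0`. -/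
theorem eRk_singleton_ne_zero_of_simple (hs : Simple M) {x b : α} (hxE : x ∈ M.E) (hbE : b ∈ M.E) (hxb : x ≠ b) :
    M.eRk ({x} : Set α) ≠ 0 := by
  intro h0
  have h2 := hs x hxE b hbE hxb
  have h3 : M.eRk ({x, b} : Set α) ≤ M.eRk ({x} : Set α) + M.eRk ({b} : Set α) := by
    rw [Set.insert_eq]
    exact M.eRk_union_le_eRk_add_eRk _ _
  rw [h2, h0, zero_add] at h3
  exact absurd (h3.trans (M.eRk_singleton_le b)) (by decide)

omit [M.Finite] in
/-- The exchange: for an independent `B`, `x ∈ cl B ∖ B` and `y ≠ x` in the fundamental circuit of `x`,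
`B − y + x` is independent (the fundamental circuit of `x` on `B ∖ y` would be a circuit inside `B ∪ x` avoiding `y`,
hence equal to the one containing `y`). -/
theorem indep_insert_erase_of_mem_fundCircuit {B : Finset α} (hB : M.Indep (B : Set α)) {x : α} (hxE : x ∈ M.E)
    (hxB : x ∉ B) {y : α} (hyC : y ∈ M.fundCircuit x (B : Set α)) (hyx : y ≠ x) :
    M.Indep ((insert x (B.erase y) : Finset α) : Set α) := by
  have hBy : M.Indep ((B.erase y : Finset α) : Set α) :=
    hB.subset (by rw [Finset.coe_erase]; exact Set.sdiff_subset)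
  have hxBy : x ∉ ((B.erase y : Finset α) : Set α) := by
    rw [Finset.mem_coe, Finset.mem_erase]
    exact fun h => hxB h.2
  rw [Finset.coe_insert, hBy.insert_indep_iff_of_notMem hxBy]
  refine ⟨hxE, fun hxcl' => ?_⟩
  have hC' := hBy.fundCircuit_isCircuit hxcl' hxBy
  have hsub : M.fundCircuit x ((B.erase y : Finset α) : Set α) ⊆ insert x (B : Set α) :=
    (M.fundCircuit_subset_insert _ _).trans
      (Set.insert_subset_insert (by rw [Finset.coe_erase]; exact Set.sdiff_subset))
  have heq := hC'.eq_fundCircuit_of_subset hB hsub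
  rw [← heq] at hyC
  rcases M.fundCircuit_subset_insert x ((B.erase y : Finset α) : Set α) hyC with h | h
  · exact hyx h
  · rw [Finset.coe_erase] at h
    exact h.2 (Set.mem_singleton y)

/-- **(H4)** A simple set `X ⊆ gr M` of rank `r ≥ 1` with `s` points has at least `1 + 2(s − r)` bases. -/
theorem one_add_two_mul_le_card_basesOf (hs : Simple M) {X : Finset α} (hX : X ⊆ gr M) {r : ℕ} (hr1 : 1 ≤ r)
    (hr : M.eRk (X : Set α) = (r : ℕ∞)) : 1 + 2 * (X.card - r) ≤ (basesOf M X r).card := by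
  classical
  obtain ⟨I, hI⟩ := M.exists_isBasis' (X : Set α)
  have hIX : I ⊆ (X : Set α) := hI.subset
  have hIfin : I.Finite := (Finset.finite_toSet X).subset hIX
  set B : Finset α := hIfin.toFinset with hBdef
  have hBI : (B : Set α) = I := hIfin.coe_toFinset
  have hBX : B ⊆ X := by
    intro z hz
    exact Finset.mem_coe.1 (hIX (by rw [← hBI]; exact Finset.mem_coe.2 hz))
  have hBind : M.Indep (B : Set α) := by rw [hBI]; exact hI.indep
  have hBcard : B.card = r := by
    have h1 := hI.eRk_eq_encard
    rw [hr, ← hBI, Set.encard_coe_eq_coe_finsetCard] at h1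
    exact_mod_cast h1.symm
  have hBrk : M.eRk (B : Set α) = (r : ℕ∞) := by
    rw [hBind.eRk_eq_encard, Set.encard_coe_eq_coe_finsetCard, hBcard]
  have hXE : (X : Set α) ⊆ M.E := by rw [← coe_gr M]; exact Finset.coe_subset.2 hX
  have hXcl : (X : Set α) ⊆ M.closure (B : Set α) := by
    rw [hBI, hI.closure_eq_closure]
    exact M.subset_closure _ hXE
  -- the exchange bases `B − y + x`
  let Cx : α → Finset α := fun x => B.filter (fun y => y ∈ M.fundCircuit x (B : Set α))
  let S : Finset (Σ _ : α, α) := (X \ B).sigma (fun x => Cx x)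
  let f : (Σ _ : α, α) → Finset α := fun p => insert p.1 (B.erase p.2)
  have hmemS : ∀ p ∈ S, p.1 ∈ X ∧ p.1 ∉ B ∧ p.2 ∈ B ∧ p.2 ∈ M.fundCircuit p.1 (B : Set α) := by
    intro p hp
    rw [Finset.mem_sigma, Finset.mem_sdiff] at hp
    have h2 := Finset.mem_filter.1 hp.2
    exact ⟨hp.1.1, hp.1.2, h2.1, h2.2⟩
  have hf_mem : ∀ p ∈ S, f p ∈ basesOf M X r := by
    intro p hp
    obtain ⟨hxX, hxB, hyB, hyC⟩ := hmemS p hp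
    have hyx : p.2 ≠ p.1 := fun h => hxB (h ▸ hyB)
    have hind := indep_insert_erase_of_mem_fundCircuit hBind (hXE (Finset.mem_coe.2 hxX)) hxB hyC hyx
    unfold basesOf
    rw [Finset.mem_filter, Finset.mem_powersetCard]
    have hcard : (insert p.1 (B.erase p.2)).card = r := by
      rw [Finset.card_insert_of_notMem (fun h => hxB (Finset.mem_of_mem_erase h)), Finset.card_erase_of_mem hyB, hBcard]
      omega
    refine ⟨⟨Finset.insert_subset hxX ((Finset.erase_subset _ _).trans hBX), hcard⟩, ?_⟩
    rw [hind.eRk_eq_encard, Set.encard_coe_eq_coe_finsetCard, hcard]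
  have hf_inj : Set.InjOn f (S : Set (Σ _ : α, α)) := by
    intro p hp q hq hpq
    obtain ⟨hxX, hxB, hyB, _⟩ := hmemS p (Finset.mem_coe.1 hp)
    obtain ⟨hxX', hxB', hyB', _⟩ := hmemS q (Finset.mem_coe.1 hq)
    have hpq' : insert p.1 (B.erase p.2) = insert q.1 (B.erase q.2) := hpq
    -- `q.1 ∈ f q = f p`, and `q.1 ∉ B`, so `q.1 = p.1`; then `p.2 ∉ f p = f q ∋ everything of B but q.2`
    have h1 : q.1 = p.1 := by
      have : q.1 ∈ insert p.1 (B.erase p.2) := hpq' ▸ Finset.mem_insert_self _ _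
      rcases Finset.mem_insert.1 this with h | h
      · exact h
      · exact absurd (Finset.mem_of_mem_erase h) hxB'
    have h2 : q.2 = p.2 := by
      by_contra hne
      have : p.2 ∈ insert q.1 (B.erase q.2) := by
        rw [Finset.mem_insert, Finset.mem_erase]
        exact Or.inr ⟨fun h => hne h.symm, hyB⟩
      rw [← hpq', Finset.mem_insert, Finset.mem_erase] at this
      rcases this with h | h
      · exact hxB (h ▸ hyB)
      · exact h.1 rfl
    exact Sigma.ext h1.symm (heq_of_eq h2.symm)
  have hB_not : B ∉ S.image f := by
    rw [Finset.mem_image]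
    rintro ⟨p, hp, hfp⟩
    obtain ⟨_, hxB, _, _⟩ := hmemS p hp
    exact hxB (hfp ▸ Finset.mem_insert_self _ _)
  have hCx : ∀ x ∈ X \ B, 2 ≤ (Cx x).card := by
    intro x hx
    rw [Finset.mem_sdiff] at hx
    have hxcl : x ∈ M.closure (B : Set α) := hXcl (Finset.mem_coe.2 hx.1)
    have hxB' : x ∉ (B : Set α) := fun h => hx.2 (Finset.mem_coe.1 h)
    have hC := hBind.fundCircuit_isCircuit hxcl hxB'
    obtain ⟨b, hbB⟩ : B.Nonempty := Finset.card_pos.1 (by omega)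
    have hxb : x ≠ b := fun h => hx.2 (h ▸ hbB)
    have hxE' : x ∈ M.E := hXE (Finset.mem_coe.2 hx.1)
    have hbE : b ∈ M.E := hXE (Finset.mem_coe.2 (hBX hbB))
    -- the circuit is not the single loop `{x}`
    have hne : ∀ e, M.fundCircuit x (B : Set α) ≠ {e} := by
      intro e heq
      have hxe : x = e := by
        have := M.mem_fundCircuit x (B : Set α)
        rw [heq] at this
        exact this
      subst hxe
      have h1 := hC.eRk_add_one_eq
      rw [heq, Set.encard_singleton] at h1
      have h0 : M.eRk ({x} : Set α) = 0 := by
        have h2 : M.eRk ({x} : Set α) + 1 = 0 + 1 := by rw [h1, zero_add]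
        exact WithTop.add_right_cancel (by simp : (1 : ℕ∞) ≠ ⊤) h2
      exact eRk_singleton_ne_zero_of_simple hs hxE' hbE hxb h0
    have h3 : 3 ≤ (M.fundCircuit x (B : Set α)).encard := three_le_encard_of_isCircuit hs hC hne
    -- `Cx x = C ∖ {x}` as a finset
    have hCxeq : ((Cx x : Finset α) : Set α) = M.fundCircuit x (B : Set α) \ {x} := by
      ext y
      simp only [Cx, Finset.coe_filter, Set.mem_setOf_eq, Set.mem_sdiff, Set.mem_singleton_iff]
      constructor
      · rintro ⟨hyB, hyC⟩
        exact ⟨hyC, fun h => hx.2 (h ▸ hyB)⟩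
      · rintro ⟨hyC, hyx⟩
        refine ⟨?_, hyC⟩
        rcases M.fundCircuit_subset_insert x (B : Set α) hyC with h | h
        · exact absurd h hyx
        · exact Finset.mem_coe.1 h
    have h4 := Set.encard_sdiff_singleton_add_one (M.mem_fundCircuit x (B : Set α))
    rw [← hCxeq, Set.encard_coe_eq_coe_finsetCard] at h4
    have h5 : (((Cx x).card : ℕ) : ℕ∞) + 1 ≥ 3 := by rw [h4]; exact h3
    have h6 : (Cx x).card + 1 ≥ 3 := by exact_mod_cast h5
    omega
  have hScard : 2 * (X \ B).card ≤ S.card := by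
    rw [Finset.card_sigma]
    calc 2 * (X \ B).card = ∑ _x ∈ X \ B, 2 := by rw [Finset.sum_const, smul_eq_mul, mul_comm]
      _ ≤ ∑ x ∈ X \ B, (Cx x).card := Finset.sum_le_sum hCx
  calc 1 + 2 * (X.card - r) = 1 + 2 * (X \ B).card := by rw [Finset.card_sdiff_of_subset hBX, hBcard]
    _ ≤ 1 + S.card := by omega
    _ = (insert B (S.image f)).card := by
        rw [Finset.card_insert_of_notMem hB_not, Finset.card_image_of_injOn hf_inj]
        ring
    _ ≤ (basesOf M X r).card := by
        refine Finset.card_le_card ?_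
        intro T hT
        rcases Finset.mem_insert.1 hT with rfl | hT
        · unfold basesOf
          rw [Finset.mem_filter, Finset.mem_powersetCard]
          exact ⟨⟨hBX, hBcard⟩, hBrk⟩
        · obtain ⟨p, hp, rfl⟩ := Finset.mem_image.1 hT
          exact hf_mem p hp

end PercRepro.Night4
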